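import Mathlib
import HarnessLib

/-!
# A weak limit of pushforwards of one law under uniformly bi-Lipschitz maps is the pushforward of
# that law under a bi-Lipschitz map (the analytic core of Cornish–Caterini–Deligiannidis–Doucet 2020,
# proof of Theorem 2.1, Supplement §B.3)

This file isolates, over general metric spaces, the limit-extraction argument of the printed
proof of [cite: CornishEtAl2020, Thm 2.1] (Supplement §B.3): if `μ` is a probability measure on a
complete separable metric space `𝒵`, `ν` one on a proper metric space `𝒳`, the maps
`f_n : 𝒵 → 𝒳` are all `M`-Lipschitz and `M`-antilipschitz ("`sup_n BiLip f_n ≤ M`"), and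
`f_n # μ ⇒ ν` weakly (integrals of bounded continuous functions converge), then some `g : 𝒵 → 𝒳`
is `M`-Lipschitz, `M`-antilipschitz and has `g # μ = ν` — **`exists_biLipschitz_map_eq_of_tendsto`**.
The companion file `TopologicalSupportObstructionSequential.lean` turns this into Theorem 2.1 and
Corollary 2.2 as printed; `TopologicalSupportObstruction.lean` holds the support lemmas
(Props. B.3/B.4/B.6) and the exact-transport case.

Steps = the printed ones [cite: CornishEtAl2020, Supplement §B.3], with three Mathlib-side
shortcuts (said at each step): (1) pointwise boundedness of `(f_n)` — `exists_forall_dist_apply_le`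
(printed: Prokhorov tightness; here: two large balls and a bump function tested against the weak
convergence); (2) a subsequence converging pointwise — `exists_subseq_tendsto_on_seq` +
`exists_tendsto_of_tendsto_dense` (printed: Arzelà–Ascoli, Thm B.9; here: sequential compactness
of a countable product of closed balls of the proper space `𝒳`, then the equi-Lipschitz `ε/3`
argument from a dense sequence); (3) the limit is bi-Lipschitz with the same constant —
`lipschitzWith_of_tendsto`, `antilipschitzWith_of_tendsto` ("taking `n' → ∞` shows
`BiLip f_∞ ≤ L`"); (4) `f_{n'} # μ ⇒ g # μ`, hence `g # μ = ν` — `map_eq_of_tendsto_pointwise`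
(printed: Portmanteau with uniform convergence on compacts, display (B.4); here: dominated
convergence from pointwise convergence, and uniqueness of the weak limit through
`ext_of_forall_integral_eq_of_IsFiniteMeasure`).

Deliberately NOT here: Arzelà–Ascoli itself in locally-uniform form (not needed); tightness /
Prokhorov (not needed); anything about supports (companion files).
-/

namespace Literature.Probability.TransportMaps

open _root_.MeasureTheory Set Filter Topology Metric BoundedContinuousFunction
open scoped _root_.Topology NNReal ENNReal

variable {Z X : Type*}

/-! ## Step 0: two elementary measure facts and a bump function -/

section Prelim

variable [PseudoMetricSpace X]

/-- A continuous bump `h : 𝒳 →ᵇ ℝ` with `0 ≤ h ≤ 1`, `h = 1` on the closed ball `B̄(x₀, r)` and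
`h = 0` off the open ball `B(x₀, r + 1)` (`h x = max 0 (min 1 (r + 1 − d(x, x₀)))`). [folklore] -/
private theorem exists_bump (x₀ : X) (r : ℝ) :
    ∃ h : X →ᵇ ℝ, (∀ x, 0 ≤ h x) ∧ (∀ x, h x ≤ 1) ∧ (∀ x, dist x x₀ ≤ r → h x = 1) ∧
      (∀ x, r + 1 ≤ dist x x₀ → h x = 0) := by
  have hcont : Continuous fun x : X => max 0 (min 1 (r + 1 - dist x x₀)) := by fun_prop
  refine ⟨BoundedContinuousFunction.ofNormedAddCommGroup _ hcont 1 ?_, ?_, ?_, ?_, ?_⟩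
  · intro x
    simp only [Real.norm_eq_abs]
    exact abs_le.2 ⟨by linarith [le_max_left 0 (min 1 (r + 1 - dist x x₀))],
      max_le zero_le_one (min_le_left _ _)⟩
  · intro x; exact le_max_left _ _
  · intro x; exact max_le zero_le_one (min_le_left _ _)
  · intro x hx
    show max 0 (min 1 (r + 1 - dist x x₀)) = 1
    rw [min_eq_left (by linarith), max_eq_right zero_le_one]
  · intro x hx
    show max 0 (min 1 (r + 1 - dist x x₀)) = 0
    exact max_eq_left ((min_le_right _ _).trans (by linarith))

variable [MeasurableSpace X]

/-- The closed balls `B̄(x, k)`, `k ∈ ℕ`, exhaust the space, so a probability measure gives one of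
them mass `> c` for any `c < 1`. [folklore] -/
private theorem exists_lt_measureReal_closedBall (μ : Measure X) [IsProbabilityMeasure μ] (x : X) {c : ℝ}
    (hc : c < 1) : ∃ k : ℕ, c < μ.real (closedBall x k) := by
  have hmono : Monotone fun k : ℕ => closedBall x (k : ℝ) :=
    fun m n hmn => closedBall_subset_closedBall (by exact_mod_cast hmn)
  have h1 : Tendsto (fun k : ℕ => μ (closedBall x k)) atTop (𝓝 1) := by
    have := tendsto_measure_iUnion_atTop (μ := μ) hmono
    rwa [iUnion_closedBall_nat, measure_univ] at this
  have hc' : ENNReal.ofReal c < 1 := ENNReal.ofReal_lt_one.2 hc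
  obtain ⟨k, hk⟩ := (h1.eventually_const_lt hc').exists
  refine ⟨k, ?_⟩
  by_cases hc0 : 0 ≤ c
  · exact (ENNReal.ofReal_lt_iff_lt_toReal hc0 (measure_ne_top μ _)).1 hk
  · exact (lt_of_lt_of_le (lt_of_not_ge hc0) measureReal_nonneg)

end Prelim

section Diagonal

variable [MetricSpace X]

/-! ## Step 2: a diagonal subsequence converging on a countable set (replaces Arzelà–Ascoli) -/

/-- **Diagonal extraction** (the Arzelà–Ascoli step of [cite: CornishEtAl2020, Supplement Thm B.9
and §B.3], in the form actually needed): if for each `k` the orbit `(f_n (d_k))_n` stays in a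
fixed closed ball of a PROPER space, then along some subsequence `φ` every `(f_{φ n} (d_k))_n`
converges.  Proof: the product of the closed balls is compact (Tychonoff) and first countable, hence
sequentially compact. -/
theorem exists_subseq_tendsto_on_seq [ProperSpace X] {f : ℕ → Z → X} (d : ℕ → Z) (x₀ : X)
    (R : ℕ → ℝ) (hR : ∀ k n, dist (f n (d k)) x₀ ≤ R k) :
    ∃ φ : ℕ → ℕ, StrictMono φ ∧ ∃ G : ℕ → X, ∀ k, Tendsto (fun n => f (φ n) (d k)) atTop (𝓝 (G k)) := by
  let S : Set (ℕ → X) := Set.pi univ fun k => closedBall x₀ (R k)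
  have hS : IsCompact S := isCompact_univ_pi fun k => isCompact_closedBall x₀ (R k)
  have hF : ∀ n, (fun k => f n (d k)) ∈ S := fun n k _ => mem_closedBall.2 (hR k n)
  obtain ⟨G, -, φ, hφ, hG⟩ := hS.isSeqCompact hF
  exact ⟨φ, hφ, G, fun k => tendsto_pi_nhds.1 hG k⟩

end Diagonal

section Limit

variable [MetricSpace Z] [MetricSpace X]

/-! ## Step 3: equi-Lipschitz + convergence on a dense sequence ⇒ pointwise convergence everywhere,
to a limit with the same bi-Lipschitz bounds -/

/-- Equi-Lipschitz maps into a complete space that converge at every point of a dense sequence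
converge everywhere [cite: CornishEtAl2020, Supplement §B.3 ("`(f_{n'})` converges pointwise to a
limit that we denote by `f_∞`")]; `ε/3` argument. -/
theorem exists_tendsto_of_tendsto_dense [CompleteSpace X] {u : ℕ → Z → X} {M : ℝ≥0}
    (hl : ∀ n, LipschitzWith M (u n)) {d : ℕ → Z} (hd : DenseRange d)
    (hconv : ∀ k, ∃ x, Tendsto (fun n => u n (d k)) atTop (𝓝 x)) :
    ∃ g : Z → X, ∀ z, Tendsto (fun n => u n z) atTop (𝓝 (g z)) := by
  have hcauchy : ∀ z, CauchySeq fun n => u n z := by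
    intro z
    refine Metric.cauchySeq_iff.2 fun ε hε => ?_
    obtain ⟨k, hk⟩ := hd.exists_dist_lt z (show 0 < ε / (3 * ((M : ℝ) + 1)) by positivity)
    obtain ⟨x, hx⟩ := hconv k
    obtain ⟨N, hN⟩ := Metric.cauchySeq_iff.1 hx.cauchySeq (ε / 3) (by positivity)
    refine ⟨N, fun m hm n hn => ?_⟩
    have hMd : (M : ℝ) * dist z (d k) < ε / 3 := by
      calc (M : ℝ) * dist z (d k) ≤ ((M : ℝ) + 1) * dist z (d k) := by
            gcongr; linarith
        _ < ((M : ℝ) + 1) * (ε / (3 * ((M : ℝ) + 1))) := by gcongr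
        _ = ε / 3 := by field_simp
    have h1 : dist (u m z) (u m (d k)) < ε / 3 := ((hl m).dist_le_mul _ _).trans_lt hMd
    have h2 : dist (u m (d k)) (u n (d k)) < ε / 3 := hN m hm n hn
    have h3 : dist (u n (d k)) (u n z) < ε / 3 := by
      rw [dist_comm]; exact ((hl n).dist_le_mul _ _).trans_lt hMd
    calc dist (u m z) (u n z)
        ≤ dist (u m z) (u m (d k)) + dist (u m (d k)) (u n (d k)) + dist (u n (d k)) (u n z) :=
          dist_triangle4 _ _ _ _
      _ < ε / 3 + ε / 3 + ε / 3 := by gcongr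
      _ = ε := by ring
  choose g hg using fun z => cauchySeq_tendsto_of_complete (hcauchy z)
  exact ⟨g, hg⟩

/-- A pointwise limit of `M`-Lipschitz maps is `M`-Lipschitz [cite: CornishEtAl2020, Supplement
§B.3 ("Taking `n' → ∞` shows that `BiLip f_∞ ≤ L`")]. -/
theorem lipschitzWith_of_tendsto {u : ℕ → Z → X} {g : Z → X} {M : ℝ≥0}
    (hl : ∀ n, LipschitzWith M (u n)) (hg : ∀ z, Tendsto (fun n => u n z) atTop (𝓝 (g z))) :
    LipschitzWith M g :=
  LipschitzWith.of_dist_le_mul fun x y =>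
    le_of_tendsto ((hg x).dist (hg y)) (Eventually.of_forall fun n => (hl n).dist_le_mul x y)

/-- A pointwise limit of `M`-antilipschitz maps is `M`-antilipschitz [cite: CornishEtAl2020,
Supplement §B.3 (same display)]. -/
theorem antilipschitzWith_of_tendsto {u : ℕ → Z → X} {g : Z → X} {M : ℝ≥0}
    (ha : ∀ n, AntilipschitzWith M (u n)) (hg : ∀ z, Tendsto (fun n => u n z) atTop (𝓝 (g z))) :
    AntilipschitzWith M g :=
  AntilipschitzWith.of_le_mul_dist fun x y =>
    ge_of_tendsto (((hg x).dist (hg y)).const_mul (M : ℝ))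
      (Eventually.of_forall fun n => (ha n).le_mul_dist x y)

end Limit

/-! ## Step 1: a uniformly Lipschitz sequence with weakly convergent pushforwards is pointwise bounded -/

section Steps

variable [MetricSpace Z] [MeasurableSpace Z] [BorelSpace Z]
  [MetricSpace X] [MeasurableSpace X] [BorelSpace X]

/-- **Pointwise boundedness** [cite: CornishEtAl2020, Supplement §B.3 (proof of Thm 2.1, first
step: "`(f_n)` is pointwise bounded")].  If the `f_n` are `M`-Lipschitz and `f_n # μ ⇒ ν` weakly
(integrals of bounded continuous functions converge), then for every `z` the orbit `(f_n z)_n` is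
bounded.  Route (a tightness-free variant of the printed one): a ball `B̄(z, ρ)` of `μ`-mass `> ¾`
and a ball `B̄(x₀, r)` of `ν`-mass `> ¾`; testing the convergence against a bump equal to `1` on
`B̄(x₀, r)` shows `μ(f_n⁻¹ B(x₀, r+1)) > ¾` eventually, so some `w ∈ B̄(z, ρ)` has
`f_n w ∈ B(x₀, r + 1)`, whence `d(f_n z, x₀) ≤ M ρ + r + 1`; the finitely many earlier `n` are
absorbed into the bound. -/
theorem exists_forall_dist_apply_le {μ : Measure Z} [IsProbabilityMeasure μ]
    {ν : Measure X} [IsProbabilityMeasure ν] {f : ℕ → Z → X} {M : ℝ≥0}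
    (hl : ∀ n, LipschitzWith M (f n))
    (hint : ∀ h : X →ᵇ ℝ, Tendsto (fun n => ∫ z, h (f n z) ∂μ) atTop (𝓝 (∫ x, h x ∂ν)))
    (x₀ : X) (z : Z) : ∃ R : ℝ, ∀ n, dist (f n z) x₀ ≤ R := by
  obtain ⟨ρ, hρ⟩ := exists_lt_measureReal_closedBall μ z (show (3 / 4 : ℝ) < 1 by norm_num)
  obtain ⟨r, hr⟩ := exists_lt_measureReal_closedBall ν x₀ (show (3 / 4 : ℝ) < 1 by norm_num)
  obtain ⟨h, h0, h1, hone, hzero⟩ := exists_bump x₀ (r : ℝ)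
  -- `∫ h dν ≥ ν(B̄(x₀, r)) > 3/4`
  have hνh : (3 / 4 : ℝ) < ∫ x, h x ∂ν := by
    refine hr.trans_le ?_
    rw [← integral_indicator_one (measurableSet_closedBall (x := x₀) (ε := (r : ℝ)))]
    refine integral_mono ((integrable_const (1 : ℝ)).indicator measurableSet_closedBall)
      (h.integrable ν) fun x => ?_
    by_cases hx : x ∈ closedBall x₀ (r : ℝ)
    · rw [indicator_of_mem hx, Pi.one_apply, hone x (mem_closedBall.1 hx)]
    · rw [indicator_of_notMem hx]; exact h0 x
  -- eventually `∫ h ∘ f_n dμ > 3/4`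
  have hev : ∀ᶠ n in atTop, (3 / 4 : ℝ) < ∫ w, h (f n w) ∂μ := (hint h).eventually_const_lt hνh
  obtain ⟨N, hN⟩ := eventually_atTop.1 hev
  -- the bound
  refine ⟨M * ρ + (r + 1) + ∑ n ∈ Finset.range N, dist (f n z) x₀, fun n => ?_⟩
  have hsum : 0 ≤ ∑ n ∈ Finset.range N, dist (f n z) x₀ :=
    Finset.sum_nonneg fun _ _ => dist_nonneg
  have hMρ : 0 ≤ (M : ℝ) * ρ + (r + 1) := by positivity
  by_cases hn : n < N
  · have : dist (f n z) x₀ ≤ ∑ m ∈ Finset.range N, dist (f m z) x₀ :=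
      Finset.single_le_sum (f := fun m => dist (f m z) x₀) (fun _ _ => dist_nonneg)
        (Finset.mem_range.2 hn)
    linarith
  · have hn' : (3 / 4 : ℝ) < ∫ w, h (f n w) ∂μ := hN n (not_lt.1 hn)
    -- `μ(f_n⁻¹ B(x₀, r+1)) > 3/4`
    have hpre : MeasurableSet (f n ⁻¹' ball x₀ (r + 1)) :=
      measurableSet_ball.preimage (hl n).continuous.measurable
    have hμpre : (3 / 4 : ℝ) < μ.real (f n ⁻¹' ball x₀ (r + 1)) := by
      refine hn'.trans_le ?_
      rw [← integral_indicator_one hpre]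
      refine integral_mono ((h.compContinuous ⟨f n, (hl n).continuous⟩).integrable μ)
        ((integrable_const (1 : ℝ)).indicator hpre) fun w => ?_
      show h (f n w) ≤ _
      by_cases hw : w ∈ f n ⁻¹' ball x₀ (r + 1)
      · rw [indicator_of_mem hw, Pi.one_apply]; exact h1 _
      · rw [indicator_of_notMem hw]
        have : (r : ℝ) + 1 ≤ dist (f n w) x₀ := by
          simpa [mem_ball, not_lt] using hw
        exact (hzero _ this).le
    -- the two big sets intersect
    have hint' : (closedBall z (ρ : ℝ) ∩ f n ⁻¹' ball x₀ (r + 1)).Nonempty := by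
      by_contra hem
      have hdisj : Disjoint (closedBall z (ρ : ℝ)) (f n ⁻¹' ball x₀ (r + 1)) :=
        disjoint_iff_inter_eq_empty.2 (not_nonempty_iff_eq_empty.1 hem)
      have hu := measureReal_union (μ := μ) hdisj hpre
      have hle : μ.real (closedBall z (ρ : ℝ) ∪ f n ⁻¹' ball x₀ (r + 1)) ≤ 1 := measureReal_le_one
      linarith
    obtain ⟨w, hw1, hw2⟩ := hint'
    have hd1 : dist (f n z) (f n w) ≤ M * ρ :=
      ((hl n).dist_le_mul z w).trans (by gcongr; exact mem_closedBall'.1 hw1)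
    have hd2 : dist (f n w) x₀ ≤ r + 1 := (mem_ball.1 hw2).le
    calc dist (f n z) x₀ ≤ dist (f n z) (f n w) + dist (f n w) x₀ := dist_triangle _ _ _
      _ ≤ M * ρ + (r + 1) + ∑ m ∈ Finset.range N, dist (f m z) x₀ := by linarith

/-! ## Step 4: the pushforwards along the subsequence converge to the pushforward of the limit,
which therefore equals the weak limit -/

/-- **Identification of the limit law** [cite: CornishEtAl2020, Supplement §B.3, display (B.4)
("`f_{n'} # P_Z ⇒ f_∞ # P_Z`", there by Portmanteau and uniform convergence on compacts; here by
dominated convergence from pointwise convergence) and "`P_X⋆ = f_∞ # P_Z`"]: if `f_n # μ ⇒ ν`,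
`φ` is a subsequence and `f_{φ n} → g` pointwise with `g` and all `f_n` continuous, then
`g # μ = ν` (limits of integrals of bounded continuous functions are unique and determine a finite
Borel measure on a metric space). -/
theorem map_eq_of_tendsto_pointwise {μ : Measure Z} [IsProbabilityMeasure μ]
    {ν : Measure X} [IsProbabilityMeasure ν] {f : ℕ → Z → X} (hf : ∀ n, Continuous (f n))
    (hint : ∀ h : X →ᵇ ℝ, Tendsto (fun n => ∫ z, h (f n z) ∂μ) atTop (𝓝 (∫ x, h x ∂ν)))
    {φ : ℕ → ℕ} (hφ : StrictMono φ) {g : Z → X} (hgc : Continuous g)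
    (hg : ∀ z, Tendsto (fun n => f (φ n) z) atTop (𝓝 (g z))) : μ.map g = ν := by
  haveI : IsProbabilityMeasure (μ.map g) := Measure.isProbabilityMeasure_map hgc.measurable.aemeasurable
  refine ext_of_forall_integral_eq_of_IsFiniteMeasure fun h => ?_
  rw [integral_map hgc.measurable.aemeasurable h.continuous.aestronglyMeasurable]
  have hA : Tendsto (fun n => ∫ z, h (f (φ n) z) ∂μ) atTop (𝓝 (∫ x, h x ∂ν)) :=
    (hint h).comp hφ.tendsto_atTop
  have hB : Tendsto (fun n => ∫ z, h (f (φ n) z) ∂μ) atTop (𝓝 (∫ z, h (g z) ∂μ)) := by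
    refine tendsto_integral_of_dominated_convergence (fun _ => ‖h‖)
      (fun n => ((h.continuous.comp (hf (φ n))).aestronglyMeasurable)) (integrable_const _)
      (fun n => Eventually.of_forall fun z => h.norm_coe_le_norm (f (φ n) z))
      (Eventually.of_forall fun z => (h.continuous.tendsto (g z)).comp (hg z))
  exact tendsto_nhds_unique hB hA

/-! ## The packaged statement: a bi-Lipschitz map transporting `μ` to the weak limit -/

/-- **Limit extraction** [cite: CornishEtAl2020, Supplement §B.3 (proof of Thm 2.1 up to display
(B.4) and "`P_X⋆ = f_∞ # P_Z`")]: on a complete separable metric space `𝒵` and a proper metric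
space `𝒳`, if `f_n # μ ⇒ ν` weakly for probability measures `μ`, `ν` and maps `f_n` that are all
`M`-Lipschitz and `M`-antilipschitz, then there is a map `g` — a pointwise subsequential limit
`f_∞` of the `f_n` — which is `M`-Lipschitz, `M`-antilipschitz and satisfies `g # μ = ν`. -/
theorem exists_biLipschitz_map_eq_of_tendsto [CompleteSpace Z] [SecondCountableTopology Z]
    [ProperSpace X] {μ : Measure Z} [IsProbabilityMeasure μ] {ν : Measure X}
    [IsProbabilityMeasure ν] {f : ℕ → Z → X} {M : ℝ≥0}
    (hl : ∀ n, LipschitzWith M (f n)) (ha : ∀ n, AntilipschitzWith M (f n))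
    (hint : ∀ h : X →ᵇ ℝ, Tendsto (fun n => ∫ z, h (f n z) ∂μ) atTop (𝓝 (∫ x, h x ∂ν))) :
    ∃ g : Z → X, LipschitzWith M g ∧ AntilipschitzWith M g ∧ μ.map g = ν := by
  -- `𝒵` is nonempty (it carries a probability measure) and has a dense sequence
  have hZ : Nonempty Z := by
    by_contra hZ
    rw [not_nonempty_iff] at hZ
    have h1 : μ univ = 1 := measure_univ
    rw [Set.univ_eq_empty_iff.2 hZ, measure_empty] at h1
    exact zero_ne_one h1
  obtain ⟨d, hd⟩ := TopologicalSpace.exists_dense_seq Z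
  have x₀ : X := f 0 (Classical.choice hZ)
  -- Step 1: pointwise bounds on the dense sequence
  choose R hR using fun k => exists_forall_dist_apply_le hl hint x₀ (d k)
  -- Step 2: diagonal subsequence
  obtain ⟨φ, hφ, G, hG⟩ := exists_subseq_tendsto_on_seq d x₀ R hR
  -- Step 3: pointwise limit everywhere, bi-Lipschitz
  have hl' : ∀ n, LipschitzWith M (f (φ n)) := fun n => hl (φ n)
  have ha' : ∀ n, AntilipschitzWith M (f (φ n)) := fun n => ha (φ n)
  obtain ⟨g, hg⟩ := exists_tendsto_of_tendsto_dense hl' hd fun k => ⟨G k, hG k⟩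
  have hgl : LipschitzWith M g := lipschitzWith_of_tendsto hl' hg
  have hga : AntilipschitzWith M g := antilipschitzWith_of_tendsto ha' hg
  -- Step 4: `g # μ = ν`
  exact ⟨g, hgl, hga,
    map_eq_of_tendsto_pointwise (fun n => (hl n).continuous) hint hφ hgl.continuous hg⟩

end Steps

end Literature.Probability.TransportMaps
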